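import Mathlib

/-!
# `NewtonTauWeak` (stmt-ValiantsHypothesis-5904), stub `fixedKCoincidence_t2_K3`: the LINE STRUCTURE of an
# exponent list

Support file (siege k16).  Every list `d : Fin N → ℕ²` admits a line structure: `s ≤ N + 1` pairwise
NON-PARALLEL nonzero directions `ep_i ∈ ℕ²` (the primitive vectors of the nonzero `d_j`, plus one dummy
direction `(1, B)` with `B` exceeding all coordinates, so that the index type is never empty), a class map
`cls` and multiplicities `mult_j ≥ 1` with `d_j = mult_j · ep_{cls j}` for every nonzero `d_j`
(`k16_exists_lines`).  Number theory used: `gcd`, and "parallel primitive vectors of `ℕ²` are equal"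
(`eq_of_parallel_coprime`). [folklore]
-/

set_option linter.dupNamespace false

noncomputable section

open scoped BigOperators

namespace Summit.ValiantsHypothesis.ValiantsHypothesis.Theorems.NewtonTauWeakFixedK3k16

/-- Parallel primitive vectors of `ℕ²` are equal. [folklore] -/
theorem eq_of_parallel_coprime (a b a' b' : ℕ) (h : Nat.Coprime a b) (h' : Nat.Coprime a' b')
    (hpar : a * b' = b * a') : a = a' ∧ b = b' := by
  have h1 : a ∣ a' := h.dvd_of_dvd_mul_left ⟨b', by linarith [hpar, mul_comm a' b]⟩
  have h2 : a' ∣ a := h'.dvd_of_dvd_mul_left ⟨b, by linarith [hpar, mul_comm b a']⟩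
  have ha : a = a' := Nat.dvd_antisymm h1 h2
  subst ha
  refine ⟨rfl, ?_⟩
  rcases Nat.eq_zero_or_pos a with h0 | hpos
  · subst h0
    rw [Nat.coprime_zero_left] at h h'
    rw [h, h']
  · have : a * b' = a * b := by rw [hpar, mul_comm]
    exact (Nat.eq_of_mul_eq_mul_left hpos this).symm

/-- **Line structure of an exponent list** (siege k16; see the file header). [folklore] -/
theorem k16_exists_lines (N : ℕ) (d : Fin N → Fin 2 →₀ ℕ) :
    ∃ (s : ℕ) (ep : Fin s → Fin 2 → ℤ) (cls : Fin N → Fin s) (mult : Fin N → ℕ),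
      s ≤ N + 1 ∧ (∀ i k, 0 ≤ ep i k) ∧ (∀ i, ep i ≠ 0) ∧
      (∀ i i', ep i 0 * ep i' 1 = ep i 1 * ep i' 0 → i = i') ∧
      (∀ j, d j ≠ 0 → 1 ≤ mult j ∧ ∀ k, ((d j k : ℕ) : ℤ) = (mult j : ℤ) * ep (cls j) k) := by
  classical
  -- the bound `B` and the primitive vectors
  set B : ℕ := 1 + ∑ j, (d j 0 + d j 1) with hB
  have hBgt : ∀ j k, d j k < B := by
    intro j k
    have : d j 0 + d j 1 ≤ ∑ j, (d j 0 + d j 1) :=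
      Finset.single_le_sum (f := fun j => d j 0 + d j 1) (fun _ _ => Nat.zero_le _) (Finset.mem_univ j)
    have hk : d j k ≤ d j 0 + d j 1 := by fin_cases k <;> simp
    omega
  set g : Fin N → ℕ := fun j => Nat.gcd (d j 0) (d j 1) with hg
  set prim : Fin N → Fin 2 → ℕ := fun j k => d j k / g j with hprim
  have hgpos : ∀ j, d j ≠ 0 → 0 < g j := by
    intro j hj
    by_contra h0
    have h0' : g j = 0 := by omega
    obtain ⟨h00, h01⟩ := Nat.gcd_eq_zero_iff.mp h0'
    apply hj; ext k; fin_cases k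
    · exact h00
    · exact h01
  have hdecomp : ∀ j k, d j k = g j * prim j k := fun j k => by
    simp only [hprim]
    rw [Nat.mul_div_cancel']
    fin_cases k
    · exact Nat.gcd_dvd_left _ _
    · exact Nat.gcd_dvd_right _ _
  have hprim_le : ∀ j k, prim j k ≤ d j k := fun j k => Nat.div_le_self _ _
  have hprim_ne : ∀ j, d j ≠ 0 → prim j ≠ 0 := by
    intro j hj h0
    apply hj; ext k
    rw [hdecomp j k, show prim j k = 0 from congr_fun h0 k, mul_zero]; rfl
  have hcop : ∀ j, d j ≠ 0 → Nat.Coprime (prim j 0) (prim j 1) := fun j hj =>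
    Nat.coprime_div_gcd_div_gcd (hgpos j hj)
  -- the set of lines and its enumeration
  set Lns : Finset (Fin 2 → ℕ) := (Finset.univ.filter fun j => d j ≠ 0).image prim with hLns
  have hmem : ∀ j, d j ≠ 0 → prim j ∈ Lns := fun j hj =>
    Finset.mem_image_of_mem prim (Finset.mem_filter.mpr ⟨Finset.mem_univ j, hj⟩)
  have hLmem : ∀ x ∈ Lns, ∃ j, d j ≠ 0 ∧ prim j = x := by
    intro x hx
    obtain ⟨j, hj, rfl⟩ := Finset.mem_image.mp hx
    exact ⟨j, (Finset.mem_filter.mp hj).2, rfl⟩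
  set eqv := Lns.equivFin with heqv
  -- directions: dummy at `0`, the lines after it
  let ep : Fin (Lns.card + 1) → Fin 2 → ℤ :=
    Fin.cases (fun k => if k = 0 then 1 else (B : ℤ)) (fun i k => (((eqv.symm i).val k : ℕ) : ℤ))
  let cls : Fin N → Fin (Lns.card + 1) := fun j =>
    if h : d j ≠ 0 then Fin.succ (eqv ⟨prim j, hmem j h⟩) else 0
  have hep0 : ∀ k, ep 0 k = if k = 0 then 1 else (B : ℤ) := fun k => rfl
  have heps : ∀ (i : Fin Lns.card) k, ep i.succ k = (((eqv.symm i).val k : ℕ) : ℤ) := fun i k => rfl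
  -- a real direction is a primitive vector of some nonzero `d j`
  have hreal : ∀ i : Fin Lns.card, ∃ j, d j ≠ 0 ∧ prim j = (eqv.symm i).val := fun i =>
    hLmem _ (eqv.symm i).property
  -- non-parallelism of a real direction with the dummy
  have hdummy : ∀ j, d j ≠ 0 → ((prim j 1 : ℕ) : ℤ) = (B : ℤ) * ((prim j 0 : ℕ) : ℤ) → False := by
    intro j hj h
    have h' : prim j 1 = B * prim j 0 := by exact_mod_cast h
    rcases Nat.eq_zero_or_pos (prim j 0) with h0 | hpos
    · rw [h0, mul_zero] at h'
      apply hprim_ne j hj; ext k; fin_cases k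
      · exact h0
      · exact h'
    · have h1 : B ≤ prim j 1 := by rw [h']; exact Nat.le_mul_of_pos_right B hpos
      have h2 := hprim_le j 1
      have h3 := hBgt j 1
      omega
  refine ⟨Lns.card + 1, ep, cls, g, ?_, ?_, ?_, ?_, ?_⟩
  · -- `s ≤ N + 1`
    have : Lns.card ≤ N := by
      calc Lns.card ≤ (Finset.univ.filter fun j => d j ≠ 0).card := Finset.card_image_le
        _ ≤ (Finset.univ : Finset (Fin N)).card := Finset.card_filter_le _ _
        _ = N := by simp
    omega
  · -- nonnegativity
    intro i k
    refine Fin.cases ?_ (fun i => ?_) i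
    · rw [hep0]; split_ifs <;> positivity
    · rw [heps]; positivity
  · -- nonzero
    intro i
    refine Fin.cases ?_ (fun i => ?_) i
    · intro h; have := congr_fun h 0; rw [hep0] at this; simp at this
    · intro h
      obtain ⟨j, hj, hpj⟩ := hreal i
      apply hprim_ne j hj
      ext k
      have := congr_fun h k
      rw [heps, ← hpj] at this
      simp only [Pi.zero_apply] at this ⊢
      exact_mod_cast this
  · -- pairwise non-parallel
    intro i i'
    refine Fin.cases ?_ (fun i => ?_) i <;> refine Fin.cases ?_ (fun i' => ?_) i'
    · intro _; rfl
    · intro h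
      exfalso
      obtain ⟨j, hj, hpj⟩ := hreal i'
      rw [hep0, hep0, heps, heps, ← hpj] at h
      simp only [if_true, one_mul, Fin.one_eq_zero_iff, OfNat.ofNat_ne_one, if_false] at h
      exact hdummy j hj (by rw [h, mul_comm])
    · intro h
      exfalso
      obtain ⟨j, hj, hpj⟩ := hreal i
      rw [hep0, hep0, heps, heps, ← hpj] at h
      simp only [if_true, mul_one, Fin.one_eq_zero_iff, OfNat.ofNat_ne_one, if_false] at h
      exact hdummy j hj (by rw [← h, mul_comm])
    · intro h
      obtain ⟨j, hj, hpj⟩ := hreal i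
      obtain ⟨j', hj', hpj'⟩ := hreal i'
      rw [heps, heps, heps, heps, ← hpj, ← hpj'] at h
      have h' : prim j 0 * prim j' 1 = prim j 1 * prim j' 0 := by exact_mod_cast h
      obtain ⟨h0, h1⟩ := eq_of_parallel_coprime _ _ _ _ (hcop j hj) (hcop j' hj') h'
      have hpp : prim j = prim j' := by ext k; fin_cases k <;> assumption
      have : eqv.symm i = eqv.symm i' := Subtype.ext (by rw [← hpj, ← hpj', hpp])
      rw [eqv.symm.injective this]
  · -- class decomposition
    intro j hj
    refine ⟨hgpos j hj, fun k => ?_⟩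
    simp only [cls, dif_pos hj, heps, Equiv.symm_apply_apply]
    rw [hdecomp j k]; push_cast; rfl

end Summit.ValiantsHypothesis.ValiantsHypothesis.Theorems.NewtonTauWeakFixedK3k16

end
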